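/-
Copyright: width seat `ym-line-sll-p5` (prover-ym-line-sll-p5-g0-0), route `SoftLoopLongLag`, cruxes K′ `SoftLoopLagFloorToTorus`
(stmt-QuantumFields-22504) / T′ `ColdBoxSoftLoopLagFloor` (stmt-QuantumFields-24180), line `birth` — engine layer of the E-architecture
(the Gaussian side of N2-loops, shared by E2 / E1b): shifted moments of SURFACE circulations of the Dirichlet Gaussian.
-/
import Summits.QuantumFields.YangMills.Theorems.SoftLoopLongLagDirichletLoopSurrogate
import Summits.QuantumFields.YangMills.Theorems.ColdBoxAllGroupsBulkAllGroupsShiftedMeanD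

/-!
# Route `SoftLoopLongLag`, E-architecture engine layer: the Gaussian side of the LOOP kernel-mean expansion WITH A DATUM — shifted second and
# fourth moments of surface circulations of the temporal-gauge Dirichlet Gaussian, `D` colours, restricted-event and datum forms
# (loop twin of `ColdBoxAllGroupsBulkAllGroupsShiftedMeanD`, group-free)

WHAT.  On the lead's loop-surrogate vocabulary (`Theorems/SoftLoopLongLagDirichletLoopSurrogate.lean`: the surface circulation
`dirSurfCirc H S s = Σ_{p ∈ S} dirCirc H p s` of the Dirichlet free edge variables through a finite plaquette set `S`, a centred Gaussian process, and
the Dirichlet mutual inductance `dirSurfInductance H S S' = Σ_{p∈S} Σ_{q∈S'} boxDirProjKernel H p q = E_D[ℓ_S ℓ_{S'}]`), this file supplies the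
`D`-colour Gaussian bookkeeping that the loop port of the sibling engine's A-mean core (`ColdBoxAllGroups.abs_kernelMeanG_sub_gaussian_le_core₂`,
whose Gaussian inputs are `memLp_two_quadObs_piD`, `integral_quadObs_sq_piD_le`, `integral_quadObs_piD_eq`) consumes when the `(1,2)`-plaquette
circulation `dirCirc H q` is replaced by the surface circulation `dirSurfCirc H S` — i.e. for the loop surrogate with background
`½ Σ_{c<D} (F_c + ℓ_S(t_c))²`:

* §1 one colour: `integral_dirSurfCirc_sq` (`E_D[ℓ_S²] = V_S := dirSurfInductance H S S`), `integral_const_add_dirSurfCirc_sq`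
  (`E_D[(F + ℓ_S)²] = F² + V_S`), `integral_dirSurfCirc_pow_four` (`E_D[ℓ_S⁴] = 3V_S²`, Wick, from the lead's `integral_dirSurfCirc_sq_mul_sq_sub`),
  `integral_const_add_dirSurfCirc_pow_four_le` (`E_D[(F + ℓ_S)⁴] ≤ 8(F⁴ + 3V_S²)`), and the affine structure of the datum's surface flux
  `sum_sCirc_glue_add_ofLp` (`Σ_{p∈S} sCirc (glue ϑ (u + t)) p = Σ_{p∈S} sCirc (glue ϑ u) p + ℓ_S(t)`, from the tree's `sCirc_glue_add_ofLp`);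
* §2 `D` colours under `D1'^{⊗D} = Measure.pi (fun _ => boxDirichlet H)` (= `ColdBoxAllGroups.gaussD H D`): `integral_quadSurf_piD_eq`
  (`E[½Σ_c (F_c + ℓ_S(t_c))²] = (D/2)·V_S + ½Σ_c F_c²`), `integral_quadSurf_sq_piD_le` (`E[(½Σ_c (F_c + ℓ_S(t_c))²)²] ≤ 2D·Σ_c (F_c⁴ + 3V_S²)`),
  `memLp_two_quadSurf_piD`, the restricted-event form `abs_integral_cond_quadSurf_sub_leD` (`√η`), and the datum forms
  `abs_integral_cond_quadSurf_datum_sub_leD` / `integral_quadSurf_datum_eqD` (background fluxes `Φ̄_c(S) = Σ_{p∈S} sCirc (glue ϑ_c (mean ϑ_c)) p`).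
At `S = {q}` these are the plaquette statements of `…ShiftedMeanD` (`dirSurfCirc H {q} = dirCirc H q`).  Pure Gaussian bookkeeping; no group,
no chart, no new definition; standard axioms; no `sorry`.

WHY.  The registered E2 `stub_innerDatumMeanSmoothG` (K′ skeleton v6 / T′ skeleton v7) is reduced (`SoftLoopLongLagInnerMeanSmoothLoopG`,
`SoftLoopLongLagInnerMeanSmoothOfExpansionG`) to N2-loops = the loop instance of the one-scale kernel-mean expansion; its assembly is the sibling's
`abs_kernelMeanG_sub_gaussian_le_core₂` with (i) the loop representation hypothesis, (ii) the R3-loop chart brick (`SoftLoopLongLagLoopCostChart`,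
seat sll-p4) as `hSur`, and (iii) THIS file as the Gaussian side (`Q t = ½Σ_c (Φ̄_c + ℓ_S(t_c))²`, value `(D/2)·V_S + ½Σ_c Φ̄_c²`, second moment
`≤ 2DΣ_c(Φ̄_c⁴ + 3V_S²)`).

HONEST LABEL: free-field bookkeeping for a RECORD-label rung line (R2xi-G, leaf `WeakCouplingRates.XiPow` = an UPPER bound on the lattice mass gap
for every compact simple `G`); NOT the Clay mass gap; no summit statement is touched.

References: S. Janson, *Gaussian Hilbert Spaces* (1997) Thm 1.28 (Wick / Isserlis); R. Durrett, *Probability* (2019) §1.6 (Cauchy–Schwarz on a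
rare event).
-/

set_option autoImplicit false

noncomputable section

open MeasureTheory ProbabilityTheory Finset Real
open Literature.Probability.LatticeModels
open Literature.MathematicalPhysics.QuantumLattice
open Literature.MathematicalPhysics.QuantumFieldTheory
open Literature.MathematicalPhysics.QuantumFieldTheory.LatticeMaxwell
open Literature.MathematicalPhysics.QuantumFieldTheory.AxialGauge
open Summit.QuantumFields.YangMills.Theorems.WeakCouplingRates
open Summit.QuantumFields.YangMills.Theorems.ColdBoxAllGroups (integrable_comp_eval_piD sq_sum_le_card_mul_sum_sq)

namespace Summit.QuantumFields.YangMills.Theorems.SoftLoopLongLag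

/-! ## §1 One colour: shifted moments of a surface circulation -/

section OneColour

variable {H : ℕ}

/-- `ℓ_S` is square integrable (Gaussian). -/
theorem memLp_two_dirSurfCirc (S : Finset (Plaq 4)) : MemLp (dirSurfCirc H S) 2 (boxDirichlet H) :=
  memLp_dirSurfCirc S (by norm_num)

/-- `ℓ_S` has a fourth moment (Gaussian). -/
theorem memLp_four_dirSurfCirc (S : Finset (Plaq 4)) : MemLp (dirSurfCirc H S) 4 (boxDirichlet H) :=
  memLp_dirSurfCirc S (by norm_num)

/-- The Dirichlet variance of a surface circulation is the self-inductance: `E_D[ℓ_S²] = V_S = dirSurfInductance H S S`. -/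
theorem integral_dirSurfCirc_sq (S : Finset (Plaq 4)) :
    ∫ s, dirSurfCirc H S s ^ 2 ∂(boxDirichlet H) = dirSurfInductance H S S := by
  have h := integral_dirSurfCirc_mul (H := H) S S
  simp_rw [← sq] at h
  exact h

/-- `V_S ≥ 0`. -/
theorem dirSurfInductance_self_nonneg (S : Finset (Plaq 4)) : 0 ≤ dirSurfInductance H S S := by
  rw [← integral_dirSurfCirc_sq]; exact integral_nonneg fun s => sq_nonneg _

/-- **Shifted second moment**: `E_D[(F + ℓ_S)²] = F² + V_S` for every constant `F`. -/
theorem integral_const_add_dirSurfCirc_sq (F : ℝ) (S : Finset (Plaq 4)) :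
    ∫ s, (F + dirSurfCirc H S s) ^ 2 ∂(boxDirichlet H) = F ^ 2 + dirSurfInductance H S S := by
  have hX : Integrable (dirSurfCirc H S) (boxDirichlet H) := (memLp_two_dirSurfCirc S).integrable one_le_two
  have hX2 : Integrable (fun s => dirSurfCirc H S s ^ 2) (boxDirichlet H) := (memLp_two_dirSurfCirc S).integrable_sq
  have hsplit : ∀ s, (F + dirSurfCirc H S s) ^ 2 = F ^ 2 + (2 * F * dirSurfCirc H S s + dirSurfCirc H S s ^ 2) := fun s => by ring
  simp_rw [hsplit]
  have hlin : Integrable (fun s => 2 * F * dirSurfCirc H S s) (boxDirichlet H) := hX.const_mul _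
  have hsum : Integrable (fun s => 2 * F * dirSurfCirc H S s + dirSurfCirc H S s ^ 2) (boxDirichlet H) := hlin.add hX2
  rw [integral_add (f := fun _ => F ^ 2) (g := fun s => 2 * F * dirSurfCirc H S s + dirSurfCirc H S s ^ 2) (integrable_const _) hsum,
    integral_add (f := fun s => 2 * F * dirSurfCirc H S s) (g := fun s => dirSurfCirc H S s ^ 2) hlin hX2, integral_const_mul,
    integral_dirSurfCirc, integral_dirSurfCirc_sq, integral_const, smul_eq_mul, probReal_univ]
  ring

/-- **Fourth moment (Wick)**: `E_D[ℓ_S⁴] = 3·V_S²`. -/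
theorem integral_dirSurfCirc_pow_four (S : Finset (Plaq 4)) :
    ∫ s, dirSurfCirc H S s ^ 4 ∂(boxDirichlet H) = 3 * dirSurfInductance H S S ^ 2 := by
  have h := integral_dirSurfCirc_sq_mul_sq_sub (H := H) S S
  have h4 : ∀ s, dirSurfCirc H S s ^ 2 * dirSurfCirc H S s ^ 2 = dirSurfCirc H S s ^ 4 := fun s => by ring
  simp_rw [h4, integral_dirSurfCirc_sq, ← sq] at h
  linarith

/-- **Shifted fourth moment**: `E_D[(F + ℓ_S)⁴] ≤ 8(F⁴ + 3V_S²)`. -/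
theorem integral_const_add_dirSurfCirc_pow_four_le (F : ℝ) (S : Finset (Plaq 4)) :
    ∫ s, (F + dirSurfCirc H S s) ^ 4 ∂(boxDirichlet H) ≤ 8 * (F ^ 4 + 3 * dirSurfInductance H S S ^ 2) := by
  have hX4 : Integrable (fun s => dirSurfCirc H S s ^ 4) (boxDirichlet H) := by
    refine ((memLp_four_dirSurfCirc S).integrable_norm_pow (by norm_num)).congr (ae_of_all _ fun s => ?_)
    simp only [Real.norm_eq_abs]
    exact (show Even 4 by decide).pow_abs _
  have hFX : MemLp (fun s => F + dirSurfCirc H S s) 4 (boxDirichlet H) := (memLp_const F).add (memLp_four_dirSurfCirc S)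
  have hint4 : Integrable (fun s => (F + dirSurfCirc H S s) ^ 4) (boxDirichlet H) := by
    refine (hFX.integrable_norm_pow (by norm_num)).congr (ae_of_all _ fun s => ?_)
    simp only [Real.norm_eq_abs]
    exact (show Even 4 by decide).pow_abs _
  have hpt : ∀ s, (F + dirSurfCirc H S s) ^ 4 ≤ 8 * (F ^ 4 + dirSurfCirc H S s ^ 4) := fun s => by
    have h1 : (F + dirSurfCirc H S s) ^ 2 ≤ 2 * (F ^ 2 + dirSurfCirc H S s ^ 2) := by
      nlinarith [sq_nonneg (F - dirSurfCirc H S s)]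
    have h2 : (F ^ 2 + dirSurfCirc H S s ^ 2) ^ 2 ≤ 2 * (F ^ 4 + dirSurfCirc H S s ^ 4) := by
      nlinarith [sq_nonneg (F ^ 2 - dirSurfCirc H S s ^ 2)]
    have h0 : 0 ≤ (F + dirSurfCirc H S s) ^ 2 := sq_nonneg _
    calc (F + dirSurfCirc H S s) ^ 4 = ((F + dirSurfCirc H S s) ^ 2) ^ 2 := by ring
      _ ≤ (2 * (F ^ 2 + dirSurfCirc H S s ^ 2)) ^ 2 := pow_le_pow_left₀ h0 h1 2
      _ = 4 * (F ^ 2 + dirSurfCirc H S s ^ 2) ^ 2 := by ring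
      _ ≤ 8 * (F ^ 4 + dirSurfCirc H S s ^ 4) := by linarith
  calc ∫ s, (F + dirSurfCirc H S s) ^ 4 ∂(boxDirichlet H) ≤ ∫ s, 8 * (F ^ 4 + dirSurfCirc H S s ^ 4) ∂(boxDirichlet H) :=
        integral_mono hint4 (((integrable_const _).add hX4).const_mul 8) hpt
    _ = 8 * (F ^ 4 + 3 * dirSurfInductance H S S ^ 2) := by
        rw [integral_const_mul, integral_add (integrable_const _) hX4, integral_const, integral_dirSurfCirc_pow_four,
          smul_eq_mul, probReal_univ, one_mul]

/-- **The datum's surface flux is affine in the free variables**: shifting the free variables by `t` adds the homogeneous surface circulation,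
`Σ_{p∈S} sCirc (glue ϑ (u + t)) p = Σ_{p∈S} sCirc (glue ϑ u) p + ℓ_S(t)` (the tree's `sCirc_glue_add_ofLp`, summed over `S`). -/
theorem sum_sCirc_glue_add_ofLp (ϑ : Literature.MathematicalPhysics.QuantumLattice.ZdEdge 4 → ℝ) (u : DirFree H → ℝ)
    (t : EuclideanSpace ℝ (DirFree H)) (S : Finset (Plaq 4)) :
    ∑ p ∈ S, sCirc (glue (pin := fun e => e ∉ dirFreeEdges H) dirCorner (2 * H + 3) ϑ (u + WithLp.ofLp t)) p =
      ∑ p ∈ S, sCirc (glue (pin := fun e => e ∉ dirFreeEdges H) dirCorner (2 * H + 3) ϑ u) p + dirSurfCirc H S t := by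
  unfold dirSurfCirc
  rw [← Finset.sum_add_distrib]
  exact Finset.sum_congr rfl fun p _ => sCirc_glue_add_ofLp ϑ u t p

end OneColour

/-! ## §2 `D` colours under the product measure `D1'^{⊗D}` -/

section DColours

variable {H D : ℕ}

/-- **`D` colours, exact mean**: `E_{D^{⊗D}}[½Σ_c (F_c + ℓ_S(t_c))²] = (D/2)·V_S + ½Σ_c F_c²`. [folklore] -/
theorem integral_quadSurf_piD_eq (F : Fin D → ℝ) (S : Finset (Plaq 4)) :
    ∫ t : Fin D → EuclideanSpace ℝ (DirFree H), (1 / 2 : ℝ) * ∑ c, (F c + dirSurfCirc H S (t c)) ^ 2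
        ∂(Measure.pi fun _ : Fin D => boxDirichlet H) =
      (D : ℝ) / 2 * dirSurfInductance H S S + 1 / 2 * ∑ c, F c ^ 2 := by
  have hint : ∀ c : Fin D, Integrable (fun t : Fin D → EuclideanSpace ℝ (DirFree H) => (F c + dirSurfCirc H S (t c)) ^ 2)
      (Measure.pi fun _ : Fin D => boxDirichlet H) := fun c =>
    integrable_comp_eval_piD (((memLp_const (F c)).add (memLp_two_dirSurfCirc S)).integrable_sq) c
  rw [integral_const_mul, integral_finsetSum _ fun c _ => hint c]
  have hc : ∀ c : Fin D, ∫ t : Fin D → EuclideanSpace ℝ (DirFree H), (F c + dirSurfCirc H S (t c)) ^ 2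
      ∂(Measure.pi fun _ : Fin D => boxDirichlet H) = F c ^ 2 + dirSurfInductance H S S := fun c => by
    rw [integral_pi_eval (boxDirichlet H) (fun s => (F c + dirSurfCirc H S s) ^ 2) c, integral_const_add_dirSurfCirc_sq]
  simp_rw [hc]
  rw [Finset.sum_add_distrib, Finset.sum_const, Finset.card_univ, Fintype.card_fin]
  simp only [nsmul_eq_mul]
  ring

/-- **`D` colours, second moment**: `E_{D^{⊗D}}[(½Σ_c (F_c + ℓ_S(t_c))²)²] ≤ 2D·Σ_c (F_c⁴ + 3V_S²)`. [folklore] -/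
theorem integral_quadSurf_sq_piD_le (F : Fin D → ℝ) (S : Finset (Plaq 4)) :
    ∫ t : Fin D → EuclideanSpace ℝ (DirFree H), ((1 / 2 : ℝ) * ∑ c, (F c + dirSurfCirc H S (t c)) ^ 2) ^ 2
        ∂(Measure.pi fun _ : Fin D => boxDirichlet H) ≤
      2 * (D : ℝ) * ∑ c, (F c ^ 4 + 3 * dirSurfInductance H S S ^ 2) := by
  set P := Measure.pi fun _ : Fin D => boxDirichlet H with hP
  have hint4 : ∀ c : Fin D, Integrable (fun t : Fin D → EuclideanSpace ℝ (DirFree H) => (F c + dirSurfCirc H S (t c)) ^ 4) P := by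
    intro c
    have hFX : MemLp (fun s => F c + dirSurfCirc H S s) 4 (boxDirichlet H) := (memLp_const (F c)).add (memLp_four_dirSurfCirc S)
    have h1 : Integrable (fun s => (F c + dirSurfCirc H S s) ^ 4) (boxDirichlet H) := by
      refine (hFX.integrable_norm_pow (by norm_num)).congr (ae_of_all _ fun s => ?_)
      simp only [Real.norm_eq_abs]
      exact (show Even 4 by decide).pow_abs _
    exact integrable_comp_eval_piD h1 c
  -- pointwise Cauchy–Schwarz: `(½Σ_c Y_c)² ≤ (D/4) Σ_c Y_c²`, `Y_c = (F_c + X_c)²`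
  have hpt : ∀ t : Fin D → EuclideanSpace ℝ (DirFree H),
      ((1 / 2 : ℝ) * ∑ c, (F c + dirSurfCirc H S (t c)) ^ 2) ^ 2 ≤ (D : ℝ) / 4 * ∑ c, (F c + dirSurfCirc H S (t c)) ^ 4 := by
    intro t
    have h := sq_sum_le_card_mul_sum_sq (D := D) (fun c => (F c + dirSurfCirc H S (t c)) ^ 2)
    have e4 : ∀ c, ((F c + dirSurfCirc H S (t c)) ^ 2) ^ 2 = (F c + dirSurfCirc H S (t c)) ^ 4 := fun c => by ring
    simp only [e4] at h
    calc ((1 / 2 : ℝ) * ∑ c, (F c + dirSurfCirc H S (t c)) ^ 2) ^ 2 = 1 / 4 * (∑ c, (F c + dirSurfCirc H S (t c)) ^ 2) ^ 2 := by ring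
      _ ≤ 1 / 4 * ((D : ℝ) * ∑ c, (F c + dirSurfCirc H S (t c)) ^ 4) := by linarith
      _ = (D : ℝ) / 4 * ∑ c, (F c + dirSurfCirc H S (t c)) ^ 4 := by ring
  have hsq_int : Integrable (fun t : Fin D → EuclideanSpace ℝ (DirFree H) =>
      ((1 / 2 : ℝ) * ∑ c, (F c + dirSurfCirc H S (t c)) ^ 2) ^ 2) P := by
    refine Integrable.mono' ((integrable_finsetSum Finset.univ fun c _ => hint4 c).const_mul ((D : ℝ) / 4)) ?_ (ae_of_all _ fun t => ?_)
    · refine (AEStronglyMeasurable.pow ?_ 2)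
      refine AEStronglyMeasurable.const_mul (Finset.aestronglyMeasurable_fun_sum _ fun c _ => ?_) _
      exact ((integrable_comp_eval_piD (((memLp_const (F c)).add (memLp_two_dirSurfCirc S)).integrable_sq) c)).aestronglyMeasurable
    · rw [Real.norm_eq_abs, abs_of_nonneg (sq_nonneg _)]
      exact hpt t
  have hD0 : (0 : ℝ) ≤ (D : ℝ) / 4 := by positivity
  calc ∫ t, ((1 / 2 : ℝ) * ∑ c, (F c + dirSurfCirc H S (t c)) ^ 2) ^ 2 ∂P
      ≤ ∫ t, (D : ℝ) / 4 * ∑ c, (F c + dirSurfCirc H S (t c)) ^ 4 ∂P :=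
        integral_mono hsq_int ((integrable_finsetSum Finset.univ fun c _ => hint4 c).const_mul _) hpt
    _ = (D : ℝ) / 4 * ∑ c, ∫ t, (F c + dirSurfCirc H S (t c)) ^ 4 ∂P := by
        rw [integral_const_mul, integral_finsetSum _ fun c _ => hint4 c]
    _ = (D : ℝ) / 4 * ∑ c, ∫ s, (F c + dirSurfCirc H S s) ^ 4 ∂(boxDirichlet H) := by
        congr 1
        refine Finset.sum_congr rfl fun c _ => ?_
        exact integral_pi_eval (boxDirichlet H) (fun s => (F c + dirSurfCirc H S s) ^ 4) c
    _ ≤ (D : ℝ) / 4 * ∑ c, 8 * (F c ^ 4 + 3 * dirSurfInductance H S S ^ 2) := by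
        refine mul_le_mul_of_nonneg_left (Finset.sum_le_sum fun c _ => ?_) hD0
        exact integral_const_add_dirSurfCirc_pow_four_le (F c) S
    _ = 2 * (D : ℝ) * ∑ c, (F c ^ 4 + 3 * dirSurfInductance H S S ^ 2) := by
        rw [← Finset.mul_sum]; ring

/-- One colour of the quadratic surface observable is square integrable under the `D`-fold product measure. [folklore] -/
theorem memLp_two_const_add_dirSurfCirc_sq_piD (F : ℝ) (S : Finset (Plaq 4)) (c : Fin D) :
    MemLp (fun t : Fin D → EuclideanSpace ℝ (DirFree H) => (F + dirSurfCirc H S (t c)) ^ 2) 2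
      (Measure.pi fun _ : Fin D => boxDirichlet H) := by
  have hFX : MemLp (fun s => F + dirSurfCirc H S s) 4 (boxDirichlet H) := (memLp_const F).add (memLp_four_dirSurfCirc S)
  have h1 : Integrable (fun s => (F + dirSurfCirc H S s) ^ 4) (boxDirichlet H) := by
    refine (hFX.integrable_norm_pow (by norm_num)).congr (ae_of_all _ fun s => ?_)
    simp only [Real.norm_eq_abs]
    exact (show Even 4 by decide).pow_abs _
  have h4 : Integrable (fun t : Fin D → EuclideanSpace ℝ (DirFree H) => (F + dirSurfCirc H S (t c)) ^ 4)
      (Measure.pi fun _ : Fin D => boxDirichlet H) := integrable_comp_eval_piD h1 c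
  have h2 : Integrable (fun t : Fin D → EuclideanSpace ℝ (DirFree H) => (F + dirSurfCirc H S (t c)) ^ 2)
      (Measure.pi fun _ : Fin D => boxDirichlet H) :=
    integrable_comp_eval_piD (((memLp_const F).add (memLp_two_dirSurfCirc S)).integrable_sq) c
  rw [memLp_two_iff_integrable_sq h2.aestronglyMeasurable]
  refine h4.congr (ae_of_all _ fun t => ?_)
  simp only
  ring

/-- The `D`-colour quadratic surface observable is square integrable under the product measure. [folklore] -/
theorem memLp_two_quadSurf_piD (F : Fin D → ℝ) (S : Finset (Plaq 4)) :
    MemLp (fun t : Fin D → EuclideanSpace ℝ (DirFree H) => (1 / 2 : ℝ) * ∑ c, (F c + dirSurfCirc H S (t c)) ^ 2) 2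
      (Measure.pi fun _ : Fin D => boxDirichlet H) :=
  (memLp_finsetSum Finset.univ fun c _ => memLp_two_const_add_dirSurfCirc_sq_piD (F c) S c).const_mul _

/-- **Gaussian evaluation after restriction to a likely event, `D` colours.**  For every measurable `G̃` of the `D`-colour space with
`D^{⊗D}(G̃ᶜ) ≤ η ≤ 1/2`:  `|E_{D^{⊗D}}[½Σ_c (F_c + ℓ_S(t_c))² | G̃] − (D/2)·V_S − ½Σ_c F_c²| ≤ 2(1 + 2D·Σ_c(F_c⁴ + 3V_S²))·√η`. [folklore] -/
theorem abs_integral_cond_quadSurf_sub_leD (F : Fin D → ℝ) (S : Finset (Plaq 4))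
    {G : Set (Fin D → EuclideanSpace ℝ (DirFree H))} (hG : MeasurableSet G) {η : ℝ}
    (hη : (Measure.pi fun _ : Fin D => boxDirichlet H).real Gᶜ ≤ η) (hη2 : η ≤ 1 / 2) :
    |(∫ t, (1 / 2 : ℝ) * ∑ c, (F c + dirSurfCirc H S (t c)) ^ 2 ∂((Measure.pi fun _ : Fin D => boxDirichlet H)[|G])) -
        ((D : ℝ) / 2 * dirSurfInductance H S S + 1 / 2 * ∑ c, F c ^ 2)| ≤
      2 * (1 + 2 * (D : ℝ) * ∑ c, (F c ^ 4 + 3 * dirSurfInductance H S S ^ 2)) * Real.sqrt η := by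
  have h1 := abs_integral_sub_integral_cond_le_of_sq (μ := Measure.pi fun _ : Fin D => boxDirichlet H) hG
    (memLp_two_quadSurf_piD F S) hη hη2
  rw [integral_quadSurf_piD_eq, abs_sub_comm] at h1
  refine h1.trans ?_
  have hη0 : 0 ≤ η := le_trans measureReal_nonneg hη
  have h2 := integral_quadSurf_sq_piD_le (H := H) F S
  have h3 : 0 ≤ Real.sqrt η := Real.sqrt_nonneg η
  nlinarith

/-- **The Gaussian side of the loop kernel-mean expansion, datum form, `D` colours.**  For one-colour Dirichlet data `ϑ : Fin D → (edges → ℝ)`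
with means `μ_c = mean ϑ_c` and background surface fluxes `Φ̄_c(S) = Σ_{p∈S} sCirc (glue ϑ_c μ_c) p`, and every measurable `G̃` with
`D^{⊗D}(G̃ᶜ) ≤ η ≤ 1/2`:
`|E_{D^{⊗D}}[½Σ_c (Σ_{p∈S} sCirc (glue ϑ_c (μ_c + t_c)) p)² | G̃] − (D/2)·V_S − ½Σ_c Φ̄_c(S)²| ≤ 2(1 + 2DΣ_c(Φ̄_c(S)⁴ + 3V_S²))·√η`. [folklore] -/
theorem abs_integral_cond_quadSurf_datum_sub_leD (ϑ : Fin D → (Literature.MathematicalPhysics.QuantumLattice.ZdEdge 4 → ℝ))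
    (S : Finset (Plaq 4)) {G : Set (Fin D → EuclideanSpace ℝ (DirFree H))} (hG : MeasurableSet G) {η : ℝ}
    (hη : (Measure.pi fun _ : Fin D => boxDirichlet H).real Gᶜ ≤ η) (hη2 : η ≤ 1 / 2) :
    |(∫ t, (1 / 2 : ℝ) * ∑ c, (∑ p ∈ S, sCirc (glue (pin := fun e => e ∉ dirFreeEdges H) dirCorner (2 * H + 3) (ϑ c)
          (mean (fun e => e ∉ dirFreeEdges H) dirCorner (2 * H + 3) (ϑ c) + WithLp.ofLp (t c))) p) ^ 2
          ∂((Measure.pi fun _ : Fin D => boxDirichlet H)[|G])) -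
        ((D : ℝ) / 2 * dirSurfInductance H S S + 1 / 2 * ∑ c, (∑ p ∈ S, sCirc (glue (pin := fun e => e ∉ dirFreeEdges H) dirCorner
          (2 * H + 3) (ϑ c) (mean (fun e => e ∉ dirFreeEdges H) dirCorner (2 * H + 3) (ϑ c))) p) ^ 2)| ≤
      2 * (1 + 2 * (D : ℝ) * ∑ c, ((∑ p ∈ S, sCirc (glue (pin := fun e => e ∉ dirFreeEdges H) dirCorner (2 * H + 3) (ϑ c)
          (mean (fun e => e ∉ dirFreeEdges H) dirCorner (2 * H + 3) (ϑ c))) p) ^ 4 + 3 * dirSurfInductance H S S ^ 2)) *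
        Real.sqrt η := by
  simp_rw [sum_sCirc_glue_add_ofLp]
  exact abs_integral_cond_quadSurf_sub_leD _ S hG hη hη2

/-- **Unrestricted form** (η-free), `D` colours:
`E_{D^{⊗D}}[½Σ_c (Σ_{p∈S} sCirc (glue ϑ_c (μ_c + t_c)) p)²] = (D/2)·V_S + ½Σ_c Φ̄_c(S)²`. [folklore] -/
theorem integral_quadSurf_datum_eqD (ϑ : Fin D → (Literature.MathematicalPhysics.QuantumLattice.ZdEdge 4 → ℝ)) (S : Finset (Plaq 4)) :
    ∫ t : Fin D → EuclideanSpace ℝ (DirFree H), (1 / 2 : ℝ) * ∑ c,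
        (∑ p ∈ S, sCirc (glue (pin := fun e => e ∉ dirFreeEdges H) dirCorner (2 * H + 3) (ϑ c)
          (mean (fun e => e ∉ dirFreeEdges H) dirCorner (2 * H + 3) (ϑ c) + WithLp.ofLp (t c))) p) ^ 2
        ∂(Measure.pi fun _ : Fin D => boxDirichlet H) =
      (D : ℝ) / 2 * dirSurfInductance H S S + 1 / 2 * ∑ c, (∑ p ∈ S, sCirc (glue (pin := fun e => e ∉ dirFreeEdges H) dirCorner
          (2 * H + 3) (ϑ c) (mean (fun e => e ∉ dirFreeEdges H) dirCorner (2 * H + 3) (ϑ c))) p) ^ 2 := by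
  simp_rw [sum_sCirc_glue_add_ofLp]
  exact integral_quadSurf_piD_eq _ S

end DColours

end Summit.QuantumFields.YangMills.Theorems.SoftLoopLongLag

end
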